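import Literature.NumberTheory.EllipticCurves.GeomPointReduction
import HarnessLib

/-!
# Roots of a GENERALISED-EISENSTEIN kernel polynomial lie strictly between `p` and `1` in absolute
# value at every place over `p`; integrality of a change of variables between `p`-integral models
# (cell `bsd-addord`, seat `bsd-addord-twist`; File C, part 1, of the Φ₀ kernel-records programme)

HONEST FRAMING (cell `bsd-addord`, `run/shared/lean/pub/bsd-addord/README.md` §4): the programme's
target of record is the full Birch–Swinnerton-Dyer formula for every `E/ℚ` of analytic rank `≤ 1`;
this is a TOOL file (valuation arithmetic at the tree's place `placeOver p` of `ℚ̄`; theorems only,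
no definition, no named fact, no `sorry`). It books nothing.

## What

Let `𝒪 = placeOver p ⊂ ℚ̄` be the tree's place over `p` (`Literature/…/GeomPointReduction.lean`),
`|·|` its valuation (`𝒪.valuation`, value group written multiplicatively), `π = |p| < 1`.

* §1 rationals at the place: `|n| ≤ 1` for `n ∈ ℤ`; `|1/n| = 1` for `p ∤ n`; the DICHOTOMY
  `|q| ≤ 1 ⇒ |q| = 1 ∨ |q| ≤ π` for `q ∈ ℚ` (`val_ratCast_eq_one_or_le`); hence `|q| > 1 ⇒ |q| ≥ π⁻¹`
  and the "integrality of exponents" `|u|¹² · π⁶ ≤ 1 ⇒ |u| ≤ 1` (`val_le_one_of_pow_twelve_mul_le`).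
* §2 **`val_root_lt_one` / `lt_val_root`**: if `h = X^m + c_{m−1}X^{m−1} + ⋯ + c₀ ∈ ℚ[X]` is monic
  of degree `m ≥ 2` with INTEGER coefficients, `p^{m−k} ∣ c_k` for `0 < k < m`, and
  `c₀ = p^{m−1}·a` with `p ∤ a` (the coefficient valuation pattern `v_p(h_1,…,h_m) = […, m−1]` of the
  canonical-subgroup kernel polynomials, `HOME/proof/phi0-p5/README.md`: all roots have
  `v_p = (m−1)/m = 1 − 2/(p−1)`), then EVERY root `α ∈ ℚ̄` of `h` satisfies `π < |α| < 1`
  (ultrametric bookkeeping: if `|α| ≥ 1` the term `α^m` dominates; if `|α| ≤ π` the term `c₀`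
  dominates). So `α` is neither `𝒪`-integral with unit nor divisible by `p`: its valuation is
  FRACTIONAL — the signature of ramification.
* §3 **`val_r_mul_le_one_of_b₂`**: for Weierstrass equations `X`, `Y = D • X` over `ℚ` with
  `p`-integral `b₂` and `|u⁻¹| ≤ 1` (`u = D.u`), `p ∤ 12`: `|r · u⁻²| ≤ 1`, from
  `b₂(D • X) = u⁻²(b₂(X) + 12r)` (Silverman *AEC* III.1 Table 3.1) — the piece of *AEC* VII.1.3(d)
  that the coordinate `x' = u⁻²(x − r)` needs.

Consumer: `Additive/RationalLineTwistRamifiedOfKernelPolynomial.lean` (the `hram` column: the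
`χ_{p*}`-twist of the certified line is the canonical subgroup of the good-ordinary twist).

References: J. H. Silverman, *AEC* 2nd ed., III.1 Table 3.1, VII.1.3(d), VII.3 [SilvermanAEC2009];
J.-P. Serre, Invent. Math. 15 (1972) §1.11 (the canonical subgroup: `v(x) = −2/(p−1)` hence
`v_p(x_W) = 1 − 2/(p−1)` on the twist) [Serre1972]; HOME/proof/phi0-p5/README.md (dictionary `hram`).
-/

set_option autoImplicit false

noncomputable section

open scoped Classical

open WeierstrassCurve Polynomial Literature.NumberTheory.EllipticCurves

namespace Summit.BirchSwinnertonDyer.Rank1Residual.Additive.KernelPolyLine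

variable (p : ℕ) [hp : Fact p.Prime]

/-! ## §1 Rationals at the place over `p` -/

/-- `|n| ≤ 1` for an integer `n`. [folklore] -/
theorem val_intCast_le_one (n : ℤ) : (placeOver p).valuation (n : AlgebraicClosure ℚ) ≤ 1 :=
  ((placeOver p).valuation_le_one_iff _).mpr (intCast_mem _ n)

/-- `|n| ≤ 1` for a natural number `n`. [folklore] -/
theorem val_natCast_le_one (n : ℕ) : (placeOver p).valuation (n : AlgebraicClosure ℚ) ≤ 1 := by
  have h := val_intCast_le_one p (n : ℤ)
  rwa [Int.cast_natCast] at h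

/-- `algebraMap ℚ ℚ̄ q = q.num / q.den`. [folklore] -/
theorem algebraMap_rat_eq_num_div_den (q : ℚ) :
    algebraMap ℚ (AlgebraicClosure ℚ) q = (q.num : AlgebraicClosure ℚ) / (q.den : AlgebraicClosure ℚ) := by
  rw [eq_ratCast, Rat.cast_def]

/-- `0 < π = |p| < 1`. [folklore] -/
theorem val_p_pos : 0 < (placeOver p).valuation ((p : ℕ) : AlgebraicClosure ℚ) :=
  (Valuation.pos_iff _).mpr (by exact_mod_cast hp.out.ne_zero)

/-- An integer divisible by `p^j` has `|n| ≤ π^j`. [folklore] -/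
theorem val_intCast_le_pow_of_dvd {n : ℤ} {j : ℕ} (h : (p : ℤ) ^ j ∣ n) :
    (placeOver p).valuation (n : AlgebraicClosure ℚ) ≤
      (placeOver p).valuation ((p : ℕ) : AlgebraicClosure ℚ) ^ j := by
  obtain ⟨c, rfl⟩ := h
  push_cast
  rw [map_mul, map_pow]
  exact mul_le_of_le_one_right' (val_intCast_le_one p c)

/-- `p^j · a` with `p ∤ a` has `|p^j a| = π^j`. [folklore] -/
theorem val_pow_mul_intCast_eq {a : ℤ} (ha : ¬ (p : ℤ) ∣ a) (j : ℕ) :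
    (placeOver p).valuation (((p : ℕ) : AlgebraicClosure ℚ) ^ j * (a : AlgebraicClosure ℚ)) =
      (placeOver p).valuation ((p : ℕ) : AlgebraicClosure ℚ) ^ j := by
  rw [map_mul, map_pow, valuation_placeOver_intCast_eq_one p ha, mul_one]

/-- **Dichotomy for rationals**: a `𝒪`-integral rational is a unit or divisible by `p`:
`|q| ≤ 1 ⇒ |q| = 1 ∨ |q| ≤ π`. [folklore] -/
theorem val_ratCast_eq_one_or_le (q : ℚ) (hq : (placeOver p).valuation (algebraMap ℚ (AlgebraicClosure ℚ) q) ≤ 1) :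
    (placeOver p).valuation (algebraMap ℚ (AlgebraicClosure ℚ) q) = 1 ∨
      (placeOver p).valuation (algebraMap ℚ (AlgebraicClosure ℚ) q) ≤
        (placeOver p).valuation ((p : ℕ) : AlgebraicClosure ℚ) := by
  rw [algebraMap_rat_eq_num_div_den] at hq ⊢
  have hden0 : (q.den : AlgebraicClosure ℚ) ≠ 0 := by exact_mod_cast q.den_nz
  have hvden0 : (placeOver p).valuation (q.den : AlgebraicClosure ℚ) ≠ 0 :=
    (Valuation.ne_zero_iff _).mpr hden0
  by_cases hnum : (p : ℤ) ∣ q.num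
  · -- `p ∣ num`, so `p ∤ den` and `|q| = |num| ≤ π`
    right
    have hcop : ¬ (p : ℤ) ∣ (q.den : ℤ) := by
      intro hden
      have h1 : p ∣ q.num.natAbs := Int.natCast_dvd.mp hnum
      have h2 : p ∣ q.den := Int.natCast_dvd_natCast.mp hden
      have h3 : p ∣ Nat.gcd q.num.natAbs q.den := Nat.dvd_gcd h1 h2
      rw [Nat.Coprime.gcd_eq_one q.reduced, Nat.dvd_one] at h3
      exact hp.out.one_lt.ne' h3
    have hvden : (placeOver p).valuation (q.den : AlgebraicClosure ℚ) = 1 := by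
      have := valuation_placeOver_intCast_eq_one p hcop
      rwa [Int.cast_natCast] at this
    rw [map_div₀, hvden, div_one]
    have h1 := val_intCast_le_pow_of_dvd p (n := q.num) (j := 1) (by rw [pow_one]; exact hnum)
    rwa [pow_one] at h1
  · -- `p ∤ num`: `|q| = 1/|den| ≥ 1`
    left
    have hvnum : (placeOver p).valuation (q.num : AlgebraicClosure ℚ) = 1 :=
      valuation_placeOver_intCast_eq_one p hnum
    rw [map_div₀, hvnum, one_div] at hq ⊢
    have hle : (placeOver p).valuation (q.den : AlgebraicClosure ℚ) ≤ 1 := val_natCast_le_one p q.den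
    have hge : 1 ≤ ((placeOver p).valuation (q.den : AlgebraicClosure ℚ))⁻¹ :=
      (one_le_inv₀ (zero_lt_iff.mpr hvden0)).mpr hle
    exact le_antisymm hq hge

/-- A rational of absolute value `> 1` has absolute value `≥ π⁻¹` (apply the dichotomy to `q⁻¹`).
[folklore] -/
theorem inv_val_p_le_of_one_lt (q : ℚ)
    (hq : 1 < (placeOver p).valuation (algebraMap ℚ (AlgebraicClosure ℚ) q)) :
    ((placeOver p).valuation ((p : ℕ) : AlgebraicClosure ℚ))⁻¹ ≤
      (placeOver p).valuation (algebraMap ℚ (AlgebraicClosure ℚ) q) := by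
  have hq0 : (placeOver p).valuation (algebraMap ℚ (AlgebraicClosure ℚ) q) ≠ 0 := ne_zero_of_lt hq
  have hinv : (placeOver p).valuation (algebraMap ℚ (AlgebraicClosure ℚ) q⁻¹) < 1 := by
    rw [map_inv₀, map_inv₀]
    exact inv_lt_one_of_one_lt₀ hq
  rcases val_ratCast_eq_one_or_le p q⁻¹ hinv.le with h1 | hle
  · exact absurd h1 hinv.ne
  · rw [map_inv₀, map_inv₀] at hle
    exact inv_le_of_inv_le₀ (zero_lt_iff.mpr hq0) hle

/-- **Integrality of exponents**: for a rational `u`, `|u|¹² · π⁶ ≤ 1 ⇒ |u| ≤ 1` (were `|u| > 1`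
then `|u| ≥ π⁻¹` and `|u|¹² π⁶ ≥ π⁻⁶ > 1`). Used with `Δ(C • V) = u⁻¹² Δ(V)`,
`Δ(V^{(p*)}) = (p*)⁶ Δ(V)`. [folklore] -/
theorem val_le_one_of_pow_twelve_mul_le (u : ℚ)
    (h : (placeOver p).valuation (algebraMap ℚ (AlgebraicClosure ℚ) u) ^ 12 *
      (placeOver p).valuation ((p : ℕ) : AlgebraicClosure ℚ) ^ 6 ≤ 1) :
    (placeOver p).valuation (algebraMap ℚ (AlgebraicClosure ℚ) u) ≤ 1 := by
  by_contra hlt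
  rw [not_le] at hlt
  have hπ := val_p_pos p
  have hπ1 := valuation_placeOver_natCast_lt_one p
  set π := (placeOver p).valuation ((p : ℕ) : AlgebraicClosure ℚ) with hπdef
  set w := (placeOver p).valuation (algebraMap ℚ (AlgebraicClosure ℚ) u) with hw
  have hge : π⁻¹ ≤ w := inv_val_p_le_of_one_lt p u hlt
  -- `π⁻¹² ≤ w¹²`, so `π⁻⁶ = π⁻¹² π⁶ ≤ w¹² π⁶ ≤ 1`, i.e. `1 ≤ π⁶ < 1`
  have h12 : π⁻¹ ^ 12 ≤ w ^ 12 := pow_le_pow_left₀ zero_le hge 12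
  have h1 : π⁻¹ ^ 12 * π ^ 6 ≤ 1 := (mul_le_mul' h12 le_rfl).trans h
  have hπ0 : π ≠ 0 := hπ.ne'
  have h2 : π⁻¹ ^ 12 * π ^ 6 = (π ^ 6)⁻¹ := by
    rw [inv_pow, show (12 : ℕ) = 6 + 6 from rfl, pow_add, mul_inv, mul_assoc,
      inv_mul_cancel₀ (pow_ne_zero _ hπ0), mul_one]
  rw [h2, inv_le_one₀ (pow_pos hπ 6)] at h1
  have h3 : π ^ 6 < 1 := pow_lt_one₀ zero_le hπ1 (by norm_num)
  exact absurd h1 (not_le.mpr h3)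

/-! ## §2 Roots of a generalised-Eisenstein polynomial -/

/-- **Every root has absolute value `< 1`.** Let `h ∈ ℚ[X]` be monic of degree `m` with integer
coefficients `c_k` divisible by `p` for all `k < m`. Then every root `α ∈ ℚ̄` of `h` has `|α| < 1`
(if `|α| ≥ 1`, the term `α^m = −Σ_{k<m} c_k α^k` has strictly larger absolute value than every
summand on the right). [folklore] -/
theorem val_root_lt_one {h : ℚ[X]} (hmon : h.Monic) {m : ℕ} (hdegm : h.natDegree = m)
    (hcoef : ∀ k, k < m → ∃ c : ℤ, h.coeff k = (c : ℚ) ∧ (p : ℤ) ∣ c)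
    {α : AlgebraicClosure ℚ} (hα : (h.map (algebraMap ℚ (AlgebraicClosure ℚ))).eval α = 0) :
    (placeOver p).valuation α < 1 := by
  set v := (placeOver p).valuation with hv
  set π := v ((p : ℕ) : AlgebraicClosure ℚ) with hπdef
  have hπ1 : π < 1 := valuation_placeOver_natCast_lt_one p
  by_contra hge
  rw [not_lt] at hge
  -- expand `h(α) = α^m + Σ_{k<m} c_k α^k`
  have hexp : (h.map (algebraMap ℚ (AlgebraicClosure ℚ))).eval α =
      ∑ i ∈ Finset.range (m + 1), algebraMap ℚ (AlgebraicClosure ℚ) (h.coeff i) * α ^ i := by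
    rw [eval_map_algebraMap, aeval_eq_sum_range' (by rw [hdegm]; exact Nat.lt_succ_self m)]
    simp only [Algebra.smul_def]
  rw [hexp, Finset.sum_range_succ, ← hdegm, hmon.coeff_natDegree, hdegm, map_one, one_mul] at hα
  -- `α^m = -Σ_{k<m} c_k α^k`
  have heq : α ^ m = -∑ i ∈ Finset.range m, algebraMap ℚ (AlgebraicClosure ℚ) (h.coeff i) * α ^ i :=
    eq_neg_of_add_eq_zero_right hα
  have hα0 : v α ≠ 0 := ne_zero_of_lt (lt_of_lt_of_le zero_lt_one hge)
  have hlt : v (∑ i ∈ Finset.range m, algebraMap ℚ (AlgebraicClosure ℚ) (h.coeff i) * α ^ i) < v α ^ m := by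
    apply Valuation.map_sum_lt _ (pow_ne_zero _ hα0)
    intro i hi
    rw [Finset.mem_range] at hi
    obtain ⟨c, hc, hpc⟩ := hcoef i hi
    rw [hc, map_intCast, map_mul, map_pow]
    have hvc : v (c : AlgebraicClosure ℚ) ≤ π := by
      have := val_intCast_le_pow_of_dvd p (j := 1) (n := c) (by rwa [pow_one])
      rwa [pow_one] at this
    calc v (c : AlgebraicClosure ℚ) * v α ^ i ≤ π * v α ^ i := mul_le_mul' hvc le_rfl
      _ < 1 * v α ^ i := by
          exact mul_lt_mul_of_lt_of_le_of_nonneg_of_pos hπ1 le_rfl zero_le (pow_pos (lt_of_lt_of_le zero_lt_one hge) _)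
      _ ≤ v α ^ (m - i) * v α ^ i := by
          rw [one_mul]
          exact le_mul_of_one_le_left' (one_le_pow_of_one_le' hge _)
      _ = v α ^ m := by rw [← pow_add, Nat.sub_add_cancel hi.le]
  have hlt' : v (α ^ m) < v α ^ m := by rw [heq, Valuation.map_neg]; exact hlt
  rw [map_pow] at hlt'
  exact lt_irrefl _ hlt'

/-- **Every root has absolute value `> π`.** Let `h ∈ ℚ[X]` be monic of degree `m ≥ 2` with integer
coefficients `c_k`, `p^{m−k} ∣ c_k` for `0 < k < m`, and `c₀ = p^{m−1} a`, `p ∤ a`. Then every root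
`α ∈ ℚ̄` of `h` has `π < |α|` (if `|α| ≤ π`, then `|c₀| = π^{m−1}` strictly exceeds every other term
of `c₀ = −α^m − Σ_{0<k<m} c_k α^k`). [folklore] -/
theorem lt_val_root {h : ℚ[X]} (hmon : h.Monic) {m : ℕ} (hdegm : h.natDegree = m) (hm : 2 ≤ m)
    (hcoef : ∀ k, 0 < k → k < m → ∃ c : ℤ, h.coeff k = (c : ℚ) ∧ (p : ℤ) ^ (m - k) ∣ c)
    (hzero : ∃ a : ℤ, h.coeff 0 = (p : ℚ) ^ (m - 1) * a ∧ ¬ (p : ℤ) ∣ a)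
    {α : AlgebraicClosure ℚ} (hα : (h.map (algebraMap ℚ (AlgebraicClosure ℚ))).eval α = 0) :
    (placeOver p).valuation ((p : ℕ) : AlgebraicClosure ℚ) < (placeOver p).valuation α := by
  set v := (placeOver p).valuation with hv
  set π := v ((p : ℕ) : AlgebraicClosure ℚ) with hπdef
  have hπ1 : π < 1 := valuation_placeOver_natCast_lt_one p
  have hπ0 : 0 < π := val_p_pos p
  by_contra hge
  rw [not_lt] at hge
  obtain ⟨a, ha, hpa⟩ := hzero
  -- expand `h(α) = α^m + Σ_{0<k<m} c_k α^k + c₀`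
  have hexp : (h.map (algebraMap ℚ (AlgebraicClosure ℚ))).eval α =
      ∑ i ∈ Finset.range (m + 1), algebraMap ℚ (AlgebraicClosure ℚ) (h.coeff i) * α ^ i := by
    rw [eval_map_algebraMap, aeval_eq_sum_range' (by rw [hdegm]; exact Nat.lt_succ_self m)]
    simp only [Algebra.smul_def]
  obtain ⟨m', rfl⟩ : ∃ m', m = m' + 1 := ⟨m - 1, by omega⟩
  rw [hexp, Finset.sum_range_succ, Finset.sum_range_succ', ← hdegm, hmon.coeff_natDegree, hdegm,
    map_one, one_mul, pow_zero, mul_one] at hα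
  -- `c₀ = -(Σ_{0<k<m} c_k α^k + α^m)`
  have heq : algebraMap ℚ (AlgebraicClosure ℚ) (h.coeff 0) =
      -(∑ i ∈ Finset.range m', algebraMap ℚ (AlgebraicClosure ℚ) (h.coeff (i + 1)) * α ^ (i + 1) +
        α ^ (m' + 1)) := by
    have : (∑ i ∈ Finset.range m', algebraMap ℚ (AlgebraicClosure ℚ) (h.coeff (i + 1)) * α ^ (i + 1) +
        α ^ (m' + 1)) + algebraMap ℚ (AlgebraicClosure ℚ) (h.coeff 0) = 0 := by
      rw [← hα]; ring
    exact eq_neg_of_add_eq_zero_right this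
  have hv0 : v (algebraMap ℚ (AlgebraicClosure ℚ) (h.coeff 0)) = π ^ m' := by
    rw [ha, map_mul, map_pow, map_natCast, map_intCast, Nat.add_sub_cancel]
    exact val_pow_mul_intCast_eq p hpa m'
  have hπm : π ^ m' ≠ 0 := pow_ne_zero _ hπ0.ne'
  -- every term on the right is `≤ π^m < π^m'`
  have hsmall : ∀ z : AlgebraicClosure ℚ, v z ≤ π ^ (m' + 1) → v z < π ^ m' := fun z hz ↦
    lt_of_le_of_lt hz (pow_lt_pow_right_of_lt_one₀ hπ0 hπ1 (Nat.lt_succ_self m'))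
  have hlt : v (∑ i ∈ Finset.range m', algebraMap ℚ (AlgebraicClosure ℚ) (h.coeff (i + 1)) * α ^ (i + 1) +
      α ^ (m' + 1)) < π ^ m' := by
    refine Valuation.map_add_lt _ ?_ ?_
    · apply Valuation.map_sum_lt _ hπm
      intro i hi
      rw [Finset.mem_range] at hi
      obtain ⟨c, hc, hpc⟩ := hcoef (i + 1) (Nat.succ_pos i) (by omega)
      apply hsmall
      rw [hc, map_intCast, map_mul, map_pow]
      have hvc : v (c : AlgebraicClosure ℚ) ≤ π ^ (m' + 1 - (i + 1)) := val_intCast_le_pow_of_dvd p hpc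
      calc v (c : AlgebraicClosure ℚ) * v α ^ (i + 1) ≤ π ^ (m' + 1 - (i + 1)) * π ^ (i + 1) :=
            mul_le_mul' hvc (pow_le_pow_left₀ zero_le hge _)
        _ = π ^ (m' + 1) := by rw [← pow_add]; congr 1; omega
    · apply hsmall
      rw [map_pow]
      exact pow_le_pow_left₀ zero_le hge _
  have hlt' : v (algebraMap ℚ (AlgebraicClosure ℚ) (h.coeff 0)) < π ^ m' := by
    rw [heq, Valuation.map_neg]; exact hlt
  rw [hv0] at hlt'
  exact lt_irrefl _ hlt'

/-! ## §3 The coordinate change between `p`-integral models: `|r u⁻²| ≤ 1` -/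

/-- **`|r · u⁻²| ≤ 1`** for `Y = D • X` with `|b₂(X)|, |b₂(Y)| ≤ 1`, `|u⁻¹| ≤ 1`, `p ∤ 6` (so
`|12| = 1`): from `b₂(D • X) = u⁻²(b₂(X) + 12r)`. [cite: SilvermanAEC2009, III.1 Table 3.1] -/
theorem val_r_mul_le_one_of_b₂ (hp5 : 5 ≤ p) {X Y : WeierstrassCurve ℚ} {D : VariableChange ℚ}
    (hD : D • X = Y)
    (hX : (placeOver p).valuation (algebraMap ℚ (AlgebraicClosure ℚ) X.b₂) ≤ 1)
    (hY : (placeOver p).valuation (algebraMap ℚ (AlgebraicClosure ℚ) Y.b₂) ≤ 1)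
    (hu : (placeOver p).valuation (algebraMap ℚ (AlgebraicClosure ℚ) (D.u⁻¹ : ℚˣ)) ≤ 1) :
    (placeOver p).valuation (algebraMap ℚ (AlgebraicClosure ℚ) (D.r * (D.u⁻¹ : ℚˣ) ^ 2)) ≤ 1 := by
  set v := (placeOver p).valuation with hv
  have hpr := hp.out
  -- `12 · r u⁻² = b₂(Y) − u⁻² b₂(X)`
  have hb : (D • X).b₂ = (D.u⁻¹ : ℚˣ) ^ 2 * (X.b₂ + 12 * D.r) := variableChange_b₂ X D
  rw [hD] at hb
  have hid : D.r * ((D.u⁻¹ : ℚˣ) : ℚ) ^ 2 = (Y.b₂ - ((D.u⁻¹ : ℚˣ) : ℚ) ^ 2 * X.b₂) * (1 / 12) := by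
    rw [hb]; ring
  have h12 : v (algebraMap ℚ (AlgebraicClosure ℚ) (1 / 12)) = 1 := by
    rw [map_div₀, map_one, one_div, map_inv₀]
    have : v (algebraMap ℚ (AlgebraicClosure ℚ) 12) = 1 := by
      rw [show (12 : ℚ) = ((12 : ℤ) : ℚ) by norm_num, map_intCast]
      apply valuation_placeOver_intCast_eq_one p
      intro hdvd
      have h12' : p ∣ 12 := by exact_mod_cast hdvd
      have := Nat.le_of_dvd (by norm_num) h12'
      interval_cases p <;> simp_all (config := {decide := true})
    rw [this, inv_one]
  have hid' : algebraMap ℚ (AlgebraicClosure ℚ) (D.r * ((D.u⁻¹ : ℚˣ) : ℚ) ^ 2) =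
      (algebraMap ℚ (AlgebraicClosure ℚ) Y.b₂ -
        algebraMap ℚ (AlgebraicClosure ℚ) ((D.u⁻¹ : ℚˣ) : ℚ) ^ 2 * algebraMap ℚ (AlgebraicClosure ℚ) X.b₂) *
        algebraMap ℚ (AlgebraicClosure ℚ) (1 / 12) := by
    rw [hid]; simp only [map_mul, map_sub, map_pow]
  rw [hid', Valuation.map_mul, h12, mul_one]
  refine Valuation.map_sub_le _ hY ?_
  rw [Valuation.map_mul, Valuation.map_pow]
  exact mul_le_one' (pow_le_one₀ zero_le hu) hX

end Summit.BirchSwinnertonDyer.Rank1Residual.Additive.KernelPolyLine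

end
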